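import Summits.ResolutionOfSingularities.ResolutionOfSingularities.Theorems.EquisingularLiftEquisingularLiftNatResidueHypDefsE10
import Mathlib.RingTheory.Smooth.Basic
import HarnessLib

/-!
# [OURS · L1 W4.5(b) · EL♮ / EL♮(3)] RESIDUE HYPOTHESIS DEFS E11 — D18♯ «SMOOTH-PARAMETER DESCENT DOOR» (D19 letters): `DescDoorAt B θ`,
# `DescDoorSharp` and the top-level disjunction blob E11 `NoseHypHostedNestEquinodalDirectCILiftTowerZeroPrimeSigmaPGBTriplePrimeDescSharp₂ := E10 ∨ DescDoorSharp`

Typed by res-type-027 g25 as a DRAFT for the desk's D19-ISO DRAWER (RULING R95 (3) 2026-08-29T16:03Z, item (d3) «letters S = D18-WIDENINGS v1.1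
§2.1 `DescDoorSharp`»; R96 (3) «drawer complete by type; letters untyped») and for the ONE ATTACKABLE LEAF «RUNG LC» (R93; idea-2 g32
`LARGE-CHAR-RUNG-idea2.md` v1.2 b5e495c61c6cff40, steps (B5) «⇒ `DescDoorAt B θ …` ⇒ `DescDoorSharp …`» and (B7) «the ♯ letters as a Defs file»).
Letters VERBATIM from idea-2 g32 `D18-WIDENINGS-idea2.md` v1.1 695dc3ad2d105b65 §2.1 — ✓ `DescDoorOver` (…DefsE10) with TWO TOKENS CHANGED:
the base `B` is any FORMALLY SMOOTH `ℤ[1/N]`-algebra (instead of `B = ℤ[1/N]`), and the point `θ : B →+* k` is GIVEN (instead of `∀ θ`).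
NOT dealt, NOT registered: a 54th registration needs a desk DEAL (R95 (3): none in this generation set).

THE IDEA (idea-2 (W1)–(W5); idea-3 ISO-HUNT rev2c (16.15)).  D18's engine base-changes a `B`-tower with `B`-flat exceptionals and `B`-smooth
centres along `B → O` and `B → k` (✓ `CentreSeq.isPullback_comap_specMap_of_exceptionalFlatOver` ×2).  Nothing in it uses `B = ℤ[1/N]` except
step (E0) «`B` maps to `O`», and for a formally smooth `B` over `ℤ[1/N]` with a given point `θ : B → k` that step is ONE Mathlib lemma:
`Algebra.FormallySmooth.exists_mkₐ_comp_eq_of_isAdicComplete` (a formally smooth algebra map to `O ⧸ 𝔪` lifts to `O` when `O` is `𝔪`-adically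
complete — ✓ `stub_wittRing` exports exactly that `O`; dressed engine-side as nose-w1 g8's pre-draft `DescSharp.exists_ringHom_lift`
db1fc426c2c433d3, farm rc 0).  So the door's true width is «`H` sits in an EQUIRESOLVABLE MIXED-CHARACTERISTIC FAMILY over a smooth base»:
centres may pass through points with arbitrary `k`-coordinates and move algebraically with continuous parameters of `H`, as long as the
family extends smoothly ACROSS `p` (W-D18♯).  For the large-characteristic rung (B3)–(B6) the base is `B := (ℤ[c]/𝔮)[1/(a a₀)]`, a smooth
`ℤ`-algebra carrying the spread of a characteristic-zero embedded resolution of the universal degree-`d` hypersurface, and `θ` = the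
coefficient point of `H`.
WHAT.  (1) `DescDoorAt B k θ n H ι` — ✓ `DescDoorOver B k n H ι`'s body with the `∀ (θ : B →+* k)` binder DELETED (`θ` is a parameter; argument
order `B k θ n H ι`).  (2) `DescDoorSharp k n H ι := ∃ N, (N : k) ≠ 0 ∧ ∃ (B : Type) [CommRing B] [Algebra ℤ[1/N] B] [Algebra.FormallySmooth ℤ[1/N] B]
(θ : B →+* k), DescDoorAt B k θ n H ι` — anonymous-instance binders INSIDE `∃` (the idiom of ✓ `ELNatConclusionO`'s `∃ (O : Type) (_ : CommRing O) …`;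
no `instance` is declared; §2.1 tokens (t1) `FormallySmooth`, not `Smooth` — it is what the engine eats and weaker for the customer; (t2) no
compatibility token between `θ` and `ℤ[1/N] → k` — ring maps out of a localisation of `ℤ` are unique, and `(N : k) ≠ 0` is KEPT as the knob the
engine reads first; (t3) `B : Type` matches `Scheme.{0}` / `∃ (O : Type)`).  (3) blob E11 := blob E10 (✓ …DefsE10) `∨ DescDoorSharp k n H ι` —
TOP-LEVEL disjunction, placement rule (L3) verbatim (no interaction with the τ0′ letters, hosts, `InvB₄`).  (4) pure logic: (t4) the `Or`-free
inclusion `descDoorSharp_of_descDoor` (`B := ℤ[1/N]` itself, Mathlib's `instance : FormallySmooth R R`, `θ` := the door's own), `descDoorAt_of_descDoorOver`,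
E10 ⇒ E11 (`Or.inl`), `DescDoorSharp` ⇒ E11 (`Or.inr`), `DescDoor` ⇒ E11, and the REPLACE chain «¬E11 ↦ ¬E10 ↦ … ↦ ¬NoseHypPointsFirstBTriplePrime».
Engine (NOT here; nose-w1's pen per R95 (3)(d4), after ✓RUNG of the 53rd): `descDoorSharp_elnat : DescDoorSharp k n H ι → ELNatConclusionO k n H ι`
= `DescSharp.exists_ringHom_lift` + ✓/⊙ `descDoorOver_elnat_of_base` at `Algebra B O := η.toAlgebra`.
OURS; NAMED HYPOTHESES, not statements of any manuscript ([Hironaka2017] is a candidate, nothing of it is asserted); AI-written, weaker than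
expert review; definitions + pure logic only, no instance, no notation, standard axioms; EL♮(3) NOT proved; resolution in positive
characteristic NOT proved.  If ever filed: `--kind definition --supports stmt-ResolutionOfSingularities-20148 --as helper`.  Names on the desk's / lead-2's word.
-/

set_option linter.dupNamespace false
noncomputable section
open CategoryTheory CategoryTheory.Limits AlgebraicGeometry TopologicalSpace Topology IsLocalRing
open Literature.AlgebraicGeometry.Resolution
open AlgebraicGeometry.Scheme.IdealSheafData
namespace Summit.ResolutionOfSingularities.ResolutionOfSingularities.Cruxes.EquisingularLiftNat.Sections

/-- **`DescDoorAt B k θ n H ι`** — the DESCENT CERTIFICATE over the base ring `B` READ AT A GIVEN POINT `θ : B →+* k` (idea-2 D18-WIDENINGS v1.1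
§2.1; ✓ `DescDoorOver B k n H ι`'s body with the `∀ (θ : B →+* k)` binder deleted): a multiple blow-up `s : CentreSeq ℙⁿ_B` of `ℙⁿ_B → Spec B`
whose EXCEPTIONAL DIVISORS ARE `B`-FLAT (✓ `CentreSeq.ExceptionalFlatOver`) and whose CENTRES ARE `B`-SMOOTH (✓ `DescCentresSmoothOver`), such that
for every graded lift `φ` of `θ` (`∀ t, φ t = MvPolynomial.map θ t`; the φ-idiom of ✓ `NoseLift₀` / ✓ `DescDoorOver`) for which
`Proj.map φ : ℙⁿ_k ⟶ ℙⁿ_B` sits in the standard fibre square over `Spec θ`, the induced k-tower `s.comap (Proj.map φ)` is an embedded resolution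
word for `range ι` (✓ `DescTransformOK … (𝟙 _) (range ι) (range ι)`).  Argument order `B k θ n H ι`.
[OURS · L1 W4.5b · named hypothesis fragment, no mathematical content of its own] -/
def DescDoorAt (B : Type) [CommRing B] (k : Type) [Field k] (θ : B →+* k) (n : ℕ) (H : AlgebraicGeometry.Scheme.{0})
    (ι : H ⟶ (Literature.AlgebraicGeometry.Motives.projectiveSpace n k).left) : Prop :=
  letI := MvPolynomial.gradedAlgebra (σ := Fin (n + 1)) (R := B)
  letI := MvPolynomial.gradedAlgebra (σ := Fin (n + 1)) (R := k)
  ∃ s : CentreSeq (AlgebraicGeometry.Proj (MvPolynomial.homogeneousSubmodule (Fin (n + 1)) B)),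
    s.ExceptionalFlatOver
        (AlgebraicGeometry.Proj.toSpecZero (MvPolynomial.homogeneousSubmodule (Fin (n + 1)) B) ≫
          AlgebraicGeometry.Spec.map (CommRingCat.ofHom (algebraMap B (MvPolynomial.homogeneousSubmodule (Fin (n + 1)) B 0)))) ∧
    DescCentresSmoothOver s
        (AlgebraicGeometry.Proj.toSpecZero (MvPolynomial.homogeneousSubmodule (Fin (n + 1)) B) ≫
          AlgebraicGeometry.Spec.map (CommRingCat.ofHom (algebraMap B (MvPolynomial.homogeneousSubmodule (Fin (n + 1)) B 0)))) ∧
    ∀ (φ : MvPolynomial.homogeneousSubmodule (Fin (n + 1)) B →+*ᵍ MvPolynomial.homogeneousSubmodule (Fin (n + 1)) k)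
      (hφ' : HomogeneousIdeal.irrelevant (MvPolynomial.homogeneousSubmodule (Fin (n + 1)) k) ≤
        (HomogeneousIdeal.irrelevant (MvPolynomial.homogeneousSubmodule (Fin (n + 1)) B)).map φ),
      (∀ t, φ t = MvPolynomial.map θ t) →
      -- the standard fibre square over `Spec θ` (the engine has it by ✓ `ProjBaseChangeRing.isPullback_projMap'`; customers may use it freely)
      IsPullback (AlgebraicGeometry.Proj.map φ hφ' :
            (Literature.AlgebraicGeometry.Motives.projectiveSpace n k).left ⟶ AlgebraicGeometry.Proj (MvPolynomial.homogeneousSubmodule (Fin (n + 1)) B))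
          (AlgebraicGeometry.Proj.toSpecZero (MvPolynomial.homogeneousSubmodule (Fin (n + 1)) k) ≫
            AlgebraicGeometry.Spec.map (CommRingCat.ofHom (algebraMap k (MvPolynomial.homogeneousSubmodule (Fin (n + 1)) k 0))))
          (AlgebraicGeometry.Proj.toSpecZero (MvPolynomial.homogeneousSubmodule (Fin (n + 1)) B) ≫
            AlgebraicGeometry.Spec.map (CommRingCat.ofHom (algebraMap B (MvPolynomial.homogeneousSubmodule (Fin (n + 1)) B 0))))
          (AlgebraicGeometry.Spec.map (CommRingCat.ofHom θ)) →
      DescTransformOK (s.comap (AlgebraicGeometry.Proj.map φ hφ' :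
            (Literature.AlgebraicGeometry.Motives.projectiveSpace n k).left ⟶ AlgebraicGeometry.Proj (MvPolynomial.homogeneousSubmodule (Fin (n + 1)) B)))
        (𝟙 (Literature.AlgebraicGeometry.Motives.projectiveSpace n k).left) (Set.range ι) (Set.range ι)

/-- **`DescDoorSharp k n H ι`** — door D18♯ «SMOOTH-PARAMETER DESCENT CERTIFICATE» (idea-2 D18-WIDENINGS v1.1 §2.1; desk R88 (5) «`DescDoorOver B`
for `B` SMOOTH over `ℤ[1/N]` with a GIVEN `θ : B →+* k`»): there are `N : ℕ` INVERTIBLE IN `k`, a FORMALLY SMOOTH `ℤ[1/N]`-algebra `B`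
(`ℤ[1/N] = Localization.Away (N : ℤ)`; `Algebra.FormallySmooth`, the Mathlib class, as an anonymous binder inside `∃` — token (t1): formal
smoothness is what the engine's lift `Algebra.FormallySmooth.exists_mkₐ_comp_eq_of_isAdicComplete` eats; finite presentation is not asked) and a
point `θ : B →+* k` with `DescDoorAt B k θ n H ι`.  No compatibility token between `θ` and `ℤ[1/N] → k` (t2: ring maps out of a localisation of `ℤ`
are unique; `(N : k) ≠ 0` is kept as the knob the engine reads first).  No `O`, no lifting slot, no Fact (ARCHITECTURE NOTE A-1 clean).
Customers (idea-3's / lead-1's call, W-D18♯): `H` in an equiresolvable mixed-characteristic family over a smooth base — every D18 / D18′ customer,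
rigid specimens in arbitrary linear position, generic members of explicit `ℤ`-flat families for `p` outside a finite set (RUNG LC (c2)); the
D19-ISO customer-in-waiting is generic `𝔅_{6,c}` (R96 (3)).  [OURS · L1 W4.5b · named hypothesis fragment, no mathematical content of its own] -/
def DescDoorSharp (k : Type) [Field k] (n : ℕ) (H : AlgebraicGeometry.Scheme.{0})
    (ι : H ⟶ (Literature.AlgebraicGeometry.Motives.projectiveSpace n k).left) : Prop :=
  ∃ (N : ℕ), (N : k) ≠ 0 ∧ ∃ (B : Type) (_ : CommRing B) (_ : Algebra (Localization.Away (N : ℤ)) B)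
    (_ : Algebra.FormallySmooth (Localization.Away (N : ℤ)) B) (θ : B →+* k), DescDoorAt B k θ n H ι

/-- **`NoseHypHostedNestEquinodalDirectCILiftTowerZeroPrimeSigmaPGBTriplePrimeDescSharp₂ k n H ι`** (blob E11) — the TOP-LEVEL disjunction
«blob E10 ∨ D18♯»: ✓ `NoseHypHostedNestEquinodalDirectCILiftTowerZeroPrimeSigmaPGBTriplePrimeDesc₂ k n H ι` (…DefsE10, the 53rd's residue blob)
`∨ DescDoorSharp k n H ι` (idea-2 (W4): same placement rule (L3) as E10 — no interaction with the τ0′ letters, hosts, `InvB₄`).  REPLACE shape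
«¬(E10 blob) ↦ ¬(this blob)» (54th-or-later, on a desk DEAL only — R95 (3)).  [OURS · L1 W4.5b · named hypothesis, no mathematical content of its own] -/
def NoseHypHostedNestEquinodalDirectCILiftTowerZeroPrimeSigmaPGBTriplePrimeDescSharp₂ (k : Type) [Field k] [IsAlgClosed k] (n : ℕ)
    (H : AlgebraicGeometry.Scheme.{0}) (ι : H ⟶ (Literature.AlgebraicGeometry.Motives.projectiveSpace n k).left) : Prop :=
  NoseHypHostedNestEquinodalDirectCILiftTowerZeroPrimeSigmaPGBTriplePrimeDesc₂ k n H ι ∨ DescDoorSharp k n H ι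

/-- `DescDoorOver B` (certificate for EVERY point `θ`) ⇒ `DescDoorAt B k θ` (certificate at the given point): instantiate the `∀ θ` binder.
[OURS · pure logic] -/
theorem descDoorAt_of_descDoorOver (B : Type) [CommRing B] (k : Type) [Field k] (θ : B →+* k) (n : ℕ)
    (H : AlgebraicGeometry.Scheme.{0}) (ι : H ⟶ (Literature.AlgebraicGeometry.Motives.projectiveSpace n k).left)
    (h : DescDoorOver B k n H ι) : DescDoorAt B k θ n H ι := by
  obtain ⟨s, hflat, hsmooth, hθ⟩ := h
  exact ⟨s, hflat, hsmooth, fun φ hφ' hφ hsq => hθ θ φ hφ' hφ hsq⟩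

/-- (t4) D18 ↪ D18♯: `DescDoor k n H ι → DescDoorSharp k n H ι` with `B := ℤ[1/N]` itself (Mathlib's `instance : Algebra.FormallySmooth R R`)
and `θ` := any ring map `ℤ[1/N] →+* k`, which exists because `(N : k) ≠ 0` (`IsLocalization.Away.lift`); the certificate at `θ` is the
door's `∀ θ` clause instantiated.  `Or`-free inclusion; pure logic + one instance term + one localisation map. [OURS · pure logic] -/
theorem descDoorSharp_of_descDoor (k : Type) [Field k] (n : ℕ) (H : AlgebraicGeometry.Scheme.{0})
    (ι : H ⟶ (Literature.AlgebraicGeometry.Motives.projectiveSpace n k).left) (h : DescDoor k n H ι) :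
    DescDoorSharp k n H ι := by
  obtain ⟨N, hN, hover⟩ := h
  -- the (unique) ring map `ℤ[1/N] → k`: `N` is a unit in the field `k`
  have hunit : IsUnit ((Int.castRingHom k) (N : ℤ)) := by
    rw [map_natCast]
    exact (Ne.isUnit hN)
  let θ : Localization.Away (N : ℤ) →+* k := IsLocalization.Away.lift (N : ℤ) hunit
  exact ⟨N, hN, Localization.Away (N : ℤ), inferInstance, inferInstance, inferInstance, θ,
    descDoorAt_of_descDoorOver _ k θ n H ι hover⟩

/-- blob E10 ⇒ blob E11 (`Or.inl`). [OURS · pure logic] -/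
theorem noseHypHostedNestEquinodalDirectCILiftTowerZeroPrimeSigmaPGBTriplePrimeDescSharp₂_of_desc₂ (k : Type) [Field k]
    [IsAlgClosed k] (n : ℕ) (H : AlgebraicGeometry.Scheme.{0}) (ι : H ⟶ (Literature.AlgebraicGeometry.Motives.projectiveSpace n k).left)
    (h : NoseHypHostedNestEquinodalDirectCILiftTowerZeroPrimeSigmaPGBTriplePrimeDesc₂ k n H ι) :
    NoseHypHostedNestEquinodalDirectCILiftTowerZeroPrimeSigmaPGBTriplePrimeDescSharp₂ k n H ι :=
  Or.inl h

/-- `DescDoorSharp` ⇒ blob E11 (`Or.inr`). [OURS · pure logic] -/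
theorem noseHypHostedNestEquinodalDirectCILiftTowerZeroPrimeSigmaPGBTriplePrimeDescSharp₂_of_descDoorSharp (k : Type) [Field k]
    [IsAlgClosed k] (n : ℕ) (H : AlgebraicGeometry.Scheme.{0}) (ι : H ⟶ (Literature.AlgebraicGeometry.Motives.projectiveSpace n k).left)
    (h : DescDoorSharp k n H ι) :
    NoseHypHostedNestEquinodalDirectCILiftTowerZeroPrimeSigmaPGBTriplePrimeDescSharp₂ k n H ι :=
  Or.inr h

/-- `DescDoor` (D18) ⇒ blob E11 (through `descDoorSharp_of_descDoor`; equally through E10's `Or.inr`). [OURS · pure logic] -/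
theorem noseHypHostedNestEquinodalDirectCILiftTowerZeroPrimeSigmaPGBTriplePrimeDescSharp₂_of_descDoor (k : Type) [Field k]
    [IsAlgClosed k] (n : ℕ) (H : AlgebraicGeometry.Scheme.{0}) (ι : H ⟶ (Literature.AlgebraicGeometry.Motives.projectiveSpace n k).left)
    (h : DescDoor k n H ι) :
    NoseHypHostedNestEquinodalDirectCILiftTowerZeroPrimeSigmaPGBTriplePrimeDescSharp₂ k n H ι :=
  Or.inr (descDoorSharp_of_descDoor k n H ι h)

/-- blob E9′ ⇒ blob E11 (`Or.inl ∘ Or.inl`). [OURS · pure logic] -/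
theorem noseHypHostedNestEquinodalDirectCILiftTowerZeroPrimeSigmaPGBTriplePrimeDescSharp₂_of_liftTowerZeroPrimeSigmaPG₂ (k : Type) [Field k]
    [IsAlgClosed k] (n : ℕ) (H : AlgebraicGeometry.Scheme.{0}) (ι : H ⟶ (Literature.AlgebraicGeometry.Motives.projectiveSpace n k).left)
    (h : NoseHypHostedNestEquinodalDirectCILiftTowerZeroPrimeSigmaPGBTriplePrime₂ k n H ι) :
    NoseHypHostedNestEquinodalDirectCILiftTowerZeroPrimeSigmaPGBTriplePrimeDescSharp₂ k n H ι :=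
  Or.inl (Or.inl h)

/-- the ΣPG blob / E8 / E9′ / E10 chain ⇒ blob E11. [OURS · pure logic] -/
theorem noseHypHostedNestEquinodalDirectCILiftTowerZeroPrimeSigmaPGBTriplePrimeDescSharp₂_of_liftSigmaPG₂ (k : Type) [Field k]
    [IsAlgClosed k] (n : ℕ) (H : AlgebraicGeometry.Scheme.{0}) (ι : H ⟶ (Literature.AlgebraicGeometry.Motives.projectiveSpace n k).left)
    (h : NoseHypHostedNestEquinodalDirectCILiftSigmaPGBTriplePrime₂ k n H ι) :
    NoseHypHostedNestEquinodalDirectCILiftTowerZeroPrimeSigmaPGBTriplePrimeDescSharp₂ k n H ι :=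
  Or.inl (noseHypHostedNestEquinodalDirectCILiftTowerZeroPrimeSigmaPGBTriplePrimeDesc₂_of_liftSigmaPG₂ k n H ι h)

/-- Contrapositive, as a D18♯ REPLACE cut «¬(E10 blob) ↦ ¬(E11 blob)» would consume it: the new residue hypothesis implies the old one.
[OURS · pure logic] -/
theorem not_noseHypHostedNestEquinodalDirectCILiftTowerZeroPrimeSigmaPGBTriplePrimeDesc₂_of_not_descSharp₂ (k : Type)
    [Field k] [IsAlgClosed k] (n : ℕ) (H : AlgebraicGeometry.Scheme.{0})
    (ι : H ⟶ (Literature.AlgebraicGeometry.Motives.projectiveSpace n k).left)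
    (h : ¬ NoseHypHostedNestEquinodalDirectCILiftTowerZeroPrimeSigmaPGBTriplePrimeDescSharp₂ k n H ι) :
    ¬ NoseHypHostedNestEquinodalDirectCILiftTowerZeroPrimeSigmaPGBTriplePrimeDesc₂ k n H ι :=
  fun h' => h (Or.inl h')

/-- … `¬ (E11 blob) → ¬ DescDoorSharp`. [OURS · pure logic] -/
theorem not_descDoorSharp_of_not_descSharp₂ (k : Type) [Field k] [IsAlgClosed k] (n : ℕ)
    (H : AlgebraicGeometry.Scheme.{0}) (ι : H ⟶ (Literature.AlgebraicGeometry.Motives.projectiveSpace n k).left)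
    (h : ¬ NoseHypHostedNestEquinodalDirectCILiftTowerZeroPrimeSigmaPGBTriplePrimeDescSharp₂ k n H ι) : ¬ DescDoorSharp k n H ι :=
  fun h' => h (Or.inr h')

/-- … `¬ (E11 blob) → ¬ DescDoor` (D18). [OURS · pure logic] -/
theorem not_descDoor_of_not_descSharp₂ (k : Type) [Field k] [IsAlgClosed k] (n : ℕ)
    (H : AlgebraicGeometry.Scheme.{0}) (ι : H ⟶ (Literature.AlgebraicGeometry.Motives.projectiveSpace n k).left)
    (h : ¬ NoseHypHostedNestEquinodalDirectCILiftTowerZeroPrimeSigmaPGBTriplePrimeDescSharp₂ k n H ι) : ¬ DescDoor k n H ι :=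
  not_descDoor_of_not_liftTowerZeroPrimeSigmaPGDesc₂ k n H ι
    (not_noseHypHostedNestEquinodalDirectCILiftTowerZeroPrimeSigmaPGBTriplePrimeDesc₂_of_not_descSharp₂ k n H ι h)

/-- … `¬ (E11 blob) → ¬ (E9′ blob)` (52nd-level). [OURS · pure logic] -/
theorem not_noseHypHostedNestEquinodalDirectCILiftTowerZeroPrimeSigmaPGBTriplePrime₂_of_not_descSharp₂ (k : Type)
    [Field k] [IsAlgClosed k] (n : ℕ) (H : AlgebraicGeometry.Scheme.{0})
    (ι : H ⟶ (Literature.AlgebraicGeometry.Motives.projectiveSpace n k).left)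
    (h : ¬ NoseHypHostedNestEquinodalDirectCILiftTowerZeroPrimeSigmaPGBTriplePrimeDescSharp₂ k n H ι) :
    ¬ NoseHypHostedNestEquinodalDirectCILiftTowerZeroPrimeSigmaPGBTriplePrime₂ k n H ι :=
  not_noseHypHostedNestEquinodalDirectCILiftTowerZeroPrimeSigmaPGBTriplePrime₂_of_not_liftTowerZeroPrimeSigmaPGDesc₂ k n H ι
    (not_noseHypHostedNestEquinodalDirectCILiftTowerZeroPrimeSigmaPGBTriplePrimeDesc₂_of_not_descSharp₂ k n H ι h)

/-- … `¬ (E11 blob) → ¬ (E8 blob)` (51st-level). [OURS · pure logic] -/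
theorem not_noseHypHostedNestEquinodalDirectCILiftSigmaPGBTriplePrime₂_of_not_descSharp₂ (k : Type) [Field k]
    [IsAlgClosed k] (n : ℕ) (H : AlgebraicGeometry.Scheme.{0}) (ι : H ⟶ (Literature.AlgebraicGeometry.Motives.projectiveSpace n k).left)
    (h : ¬ NoseHypHostedNestEquinodalDirectCILiftTowerZeroPrimeSigmaPGBTriplePrimeDescSharp₂ k n H ι) :
    ¬ NoseHypHostedNestEquinodalDirectCILiftSigmaPGBTriplePrime₂ k n H ι :=
  not_noseHypHostedNestEquinodalDirectCILiftSigmaPGBTriplePrime₂_of_not_liftTowerZeroPrimeSigmaPGDesc₂ k n H ι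
    (not_noseHypHostedNestEquinodalDirectCILiftTowerZeroPrimeSigmaPGBTriplePrimeDesc₂_of_not_descSharp₂ k n H ι h)

/-- … `¬ (E11 blob) → ¬ (ΣPG blob)` (50th-level). [OURS · pure logic] -/
theorem not_noseHypHostedNestEquinodalDirectCISigmaPGBTriplePrime₂_of_not_descSharp₂ (k : Type) [Field k]
    [IsAlgClosed k] (n : ℕ) (H : AlgebraicGeometry.Scheme.{0}) (ι : H ⟶ (Literature.AlgebraicGeometry.Motives.projectiveSpace n k).left)
    (h : ¬ NoseHypHostedNestEquinodalDirectCILiftTowerZeroPrimeSigmaPGBTriplePrimeDescSharp₂ k n H ι) :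
    ¬ NoseHypHostedNestEquinodalDirectCISigmaPGBTriplePrime₂ k n H ι :=
  not_noseHypHostedNestEquinodalDirectCISigmaPGBTriplePrime₂_of_not_liftTowerZeroPrimeSigmaPGDesc₂ k n H ι
    (not_noseHypHostedNestEquinodalDirectCILiftTowerZeroPrimeSigmaPGBTriplePrimeDesc₂_of_not_descSharp₂ k n H ι h)

/-- … `¬ (E11 blob) → ¬ (Σ blob)` (49th-level). [OURS · pure logic] -/
theorem not_noseHypHostedNestEquinodalDirectCISigmaBTriplePrime₂_of_not_descSharp₂ (k : Type) [Field k]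
    [IsAlgClosed k] (n : ℕ) (H : AlgebraicGeometry.Scheme.{0}) (ι : H ⟶ (Literature.AlgebraicGeometry.Motives.projectiveSpace n k).left)
    (h : ¬ NoseHypHostedNestEquinodalDirectCILiftTowerZeroPrimeSigmaPGBTriplePrimeDescSharp₂ k n H ι) :
    ¬ NoseHypHostedNestEquinodalDirectCISigmaBTriplePrime₂ k n H ι :=
  not_noseHypHostedNestEquinodalDirectCISigmaBTriplePrime₂_of_not_liftTowerZeroPrimeSigmaPGDesc₂ k n H ι
    (not_noseHypHostedNestEquinodalDirectCILiftTowerZeroPrimeSigmaPGBTriplePrimeDesc₂_of_not_descSharp₂ k n H ι h)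

/-- … `¬ (E11 blob) → ¬ (47th blob)`. [OURS · pure logic] -/
theorem not_noseHypHostedNestEquinodalDirectCIBTriplePrime₂_of_not_descSharp₂ (k : Type) [Field k]
    [IsAlgClosed k] (n : ℕ) (H : AlgebraicGeometry.Scheme.{0}) (ι : H ⟶ (Literature.AlgebraicGeometry.Motives.projectiveSpace n k).left)
    (h : ¬ NoseHypHostedNestEquinodalDirectCILiftTowerZeroPrimeSigmaPGBTriplePrimeDescSharp₂ k n H ι) :
    ¬ NoseHypHostedNestEquinodalDirectCIBTriplePrime₂ k n H ι :=
  not_noseHypHostedNestEquinodalDirectCIBTriplePrime₂_of_not_liftTowerZeroPrimeSigmaPGDesc₂ k n H ι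
    (not_noseHypHostedNestEquinodalDirectCILiftTowerZeroPrimeSigmaPGBTriplePrimeDesc₂_of_not_descSharp₂ k n H ι h)

/-- … `¬ (E11 blob) → ¬ (46th blob)`. [OURS · pure logic] -/
theorem not_noseHypHostedNestEquinodalDirectBTriplePrime₂_of_not_descSharp₂ (k : Type) [Field k]
    [IsAlgClosed k] (n : ℕ) (H : AlgebraicGeometry.Scheme.{0}) (ι : H ⟶ (Literature.AlgebraicGeometry.Motives.projectiveSpace n k).left)
    (h : ¬ NoseHypHostedNestEquinodalDirectCILiftTowerZeroPrimeSigmaPGBTriplePrimeDescSharp₂ k n H ι) :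
    ¬ NoseHypHostedNestEquinodalDirectBTriplePrime₂ k n H ι :=
  not_noseHypHostedNestEquinodalDirectBTriplePrime₂_of_not_liftTowerZeroPrimeSigmaPGDesc₂ k n H ι
    (not_noseHypHostedNestEquinodalDirectCILiftTowerZeroPrimeSigmaPGBTriplePrimeDesc₂_of_not_descSharp₂ k n H ι h)

/-- … `¬ (E11 blob) → ¬ blob₃ᵉ v2`. [OURS · pure logic] -/
theorem not_noseHypHostedNestEquinodalBTriplePrime₂_of_not_descSharp₂ (k : Type) [Field k]
    [IsAlgClosed k] (n : ℕ) (H : AlgebraicGeometry.Scheme.{0}) (ι : H ⟶ (Literature.AlgebraicGeometry.Motives.projectiveSpace n k).left)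
    (h : ¬ NoseHypHostedNestEquinodalDirectCILiftTowerZeroPrimeSigmaPGBTriplePrimeDescSharp₂ k n H ι) :
    ¬ NoseHypHostedNestEquinodalBTriplePrime₂ k n H ι :=
  not_noseHypHostedNestEquinodalBTriplePrime₂_of_not_liftTowerZeroPrimeSigmaPGDesc₂ k n H ι
    (not_noseHypHostedNestEquinodalDirectCILiftTowerZeroPrimeSigmaPGBTriplePrimeDesc₂_of_not_descSharp₂ k n H ι h)

/-- … `¬ (E11 blob) → ¬ blob₂`. [OURS · pure logic] -/
theorem not_noseHypHostedNestBTriplePrime₂_of_not_descSharp₂ (k : Type) [Field k]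
    [IsAlgClosed k] (n : ℕ) (H : AlgebraicGeometry.Scheme.{0}) (ι : H ⟶ (Literature.AlgebraicGeometry.Motives.projectiveSpace n k).left)
    (h : ¬ NoseHypHostedNestEquinodalDirectCILiftTowerZeroPrimeSigmaPGBTriplePrimeDescSharp₂ k n H ι) :
    ¬ NoseHypHostedNestBTriplePrime₂ k n H ι :=
  not_noseHypHostedNestBTriplePrime₂_of_not_liftTowerZeroPrimeSigmaPGDesc₂ k n H ι
    (not_noseHypHostedNestEquinodalDirectCILiftTowerZeroPrimeSigmaPGBTriplePrimeDesc₂_of_not_descSharp₂ k n H ι h)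

/-- … `¬ (E11 blob) → ¬ NoseHypPointsFirstBTriplePrime`. [OURS · pure logic] -/
theorem not_noseHypPointsFirstBTriplePrime_of_not_descSharp₂ (k : Type) [Field k]
    [IsAlgClosed k] (n : ℕ) (H : AlgebraicGeometry.Scheme.{0}) (ι : H ⟶ (Literature.AlgebraicGeometry.Motives.projectiveSpace n k).left)
    (h : ¬ NoseHypHostedNestEquinodalDirectCILiftTowerZeroPrimeSigmaPGBTriplePrimeDescSharp₂ k n H ι) :
    ¬ NoseHypPointsFirstBTriplePrime k n H ι :=
  not_noseHypPointsFirstBTriplePrime_of_not_liftTowerZeroPrimeSigmaPGDesc₂ k n H ι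
    (not_noseHypHostedNestEquinodalDirectCILiftTowerZeroPrimeSigmaPGBTriplePrimeDesc₂_of_not_descSharp₂ k n H ι h)

end Summit.ResolutionOfSingularities.ResolutionOfSingularities.Cruxes.EquisingularLiftNat.Sections

end
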